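import Literature.AnabelianGeometry.AbsoluteAnabelian.AbsTopIII.FrobeniusPictureMLFTelecoreIncompatibility

/-!
# [AbsTopIII] Corollary 3.6 (iv), first incompatibility: DERIVED from the Lemma-3.4 obstruction

S. Mochizuki, *Topics in Absolute Anabelian Geometry III*, Cor. 3.6 (iv) and its proof, pp. 80–81
of the manuscript `paper:url-5493eb38cbb7` (bib key `MochizukiAbsTopIII2015`).  Companion of
`AbsTopIII/FrobeniusPictureMLF.lean` (block W2-B1, node `AbsTopIII:Cor3.6(iv)`).

"Suppose that `𝒟_{≤2}` admits a structure of core on `𝒟_{≤1}` in a fashion that is compatible with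
the observable `𝔖_log` of (iii).  Then this core structure determines, for `⋎ ∈ L`, a homotopy `ζ₀`
for the pair of paths `([id_{⋎+1}], [id_⋎]∘[log])`; thus, by composing the result `ζ'₀` of applying
`λ^×` to `ζ₀` with the homotopy `ζ₁` associated [via `𝔖_log`] to the pair of paths
`([λ^×]∘[id_⋎]∘[log], [λ^{×pf}]∘[id_{⋎+1}])` [of type (1)], we obtain a natural transformation
`ζ'₁ = ζ₁ ∘ ζ'₀ : λ^× ∘ id_{⋎+1} → λ^{×pf} ∘ id_{⋎+1}` — which, in order for the desired compatibility
to hold, must coincide with the homotopy `ζ₂` associated [via `𝔖_log`] to the pair of paths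
`([λ^×]∘[id_{⋎+1}], [λ^{×pf}]∘[id_{⋎+1}])` [of type (2)].  On the other hand, by writing out
explicitly the meaning of such an equality `ζ'₁ = ζ₂`, we conclude that we obtain a contradiction
to Lemma 3.4." (p. 81)

This file deduces the typed first incompatibility `LogFrobeniusData.IncompatibleStmt` (§3
direction `ι_× : λ^× → λ^{×pf}`) from the Lemma-3.4 property of the abstract data
(`LogFrobeniusData.Lemma34Property`, `FrobeniusPictureMLFTelecoreIncompatibility.lean`).  The
categorical half of the argument is the general theorem
`false_of_prefixed_core_compatible_of_obstruction_left` of that file (the printed argument behind a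
prefix edge; its unprefixed form is abc-iut-L4-t10's `false_of_core_compatible_of_obstruction_left`):
we apply it behind the prefix edge `log : 𝒳_{⋎+2} → 𝒳_{⋎+1}` of the first row — the would-be core
homotopy `ζ₀` for `([id_{⋎+1}], [id_⋎]∘[log])`, pre-composed with `[log]` by saturation, is again an
isomorphism, and the Lemma-3.4 property at the object `log(x₀)` concludes.  Nothing here takes a
side on inter-universal Teichmüller theory.
-/

namespace Literature.AnabelianGeometry.AbsoluteAnabelian.LogFrobeniusData

open _root_.CategoryTheory _root_.Quiver

universe u

variable {Δ : LogFrobeniusData.{u}}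

/-- **Cor. 3.6 (iv), first incompatibility, from Lemma 3.4.**  For input data of MLF-Galois type
(`ι_× = ι : λ^× → λ^{×pf}`, the §3 direction) whose first row has an object `x₀` and which satisfies
the Lemma-3.4 property, "`𝒟_{≤2}` does not admit a structure of core on `𝒟_{≤1}` … compatible with …
the observable `𝔖_log`", in the typed form `LogFrobeniusData.IncompatibleStmt`: a common family
would contain the isomorphism `ζ₀` for `([id_{⋎+1}], [id_⋎]∘[log])` — hence, by pre-composition with
the edge `log : ⋎+2 → ⋎+1`, an isomorphism for `([id_{⋎+1}]∘[log], [id_⋎]∘[log]∘[log])` — and the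
`𝔖_log` homotopies `ι_{log,⋎}`, `ι_×`, forcing `λ^×(α) ≫ ι_{log,⋎}(log x₀) = ι_×(id_{⋎+1}(log x₀))` for
an isomorphism `α`, contradicting the Lemma-3.4 property.
[cite: MochizukiAbsTopIII2015, Corollary 3.6 (iv) p.81] -/
theorem incompatibleStmt_of_lemma34 (ι : Δ.lamTimes ⟶ Δ.lamPf) (hι : Δ.ιtimes = Sum.inl ι)
    (x₀ : Δ.X₁) (h34 : Lemma34Property ι) : Δ.IncompatibleStmt := by
  rintro ⟨K, hcore, htimes, hlog⟩
  obtain ⟨h₀, hiso⟩ := hcore 0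
  rw [hι] at htimes
  obtain ⟨hT, hhT⟩ := htimes
  obtain ⟨h₁, hh₁⟩ := hlog 0
  -- pre-compose the would-be core pair with the edge `log : (0+1)+1 → 0+1`
  let r : Path (lvRow1.{u} (0 + 1 + 1)) (lvRow1.{u} (0 + 1)) :=
    (Path.nil : Path (lvRow1.{u} (0 + 1 + 1)) (lvRow1 (0 + 1 + 1))).cons
      (show lvRow1.{u} (0 + 1 + 1) ⟶ lvRow1 (0 + 1) from LFVertex.logEdge (0 + 1))
  have h₀' := K.isSaturated.precomp (K.isSaturated.postcomp h₀ Path.nil) r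
  have hiso' : IsIso (K.η h₀') := by
    rw [K.η_whisker h₀ r Path.nil]
    haveI := hiso
    infer_instance
  exact false_of_prefixed_core_compatible_of_obstruction_left K
    (w := lvRow1.{u} (0 + 1 + 1)) (v1 := lvRow1.{u} (0 + 1)) (v0 := lvRow1.{u} 0) (sq := lvNexus.{u})
    (ob := lvObs.{u}) (show lvRow1.{u} (0 + 1 + 1) ⟶ lvRow1 (0 + 1) from LFVertex.logEdge (0 + 1))
    (LFVertex.logEdge 0) (LFVertex.idEdge (0 + 1)) (LFVertex.idEdge 0) eLamTimes eLamPf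
    ι Δ.ιlog h₀' hiso' hT hhT h₁ hh₁ x₀ (fun a ha => h34 _ a ha)

end Literature.AnabelianGeometry.AbsoluteAnabelian.LogFrobeniusData
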